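import Mathlib
import HarnessLib
import Summits.NavierStokesRegularity.NavierStokesRegularity.Theorems.UnthreadedDoorAntidynamoWallBeltramiModConst

/-!
# Route `UnthreadedDoor` / `ThreadingFlux`, crux `PoloidalLiouville` (stmt-NavierStokesRegularity-1222), antidynamo v2 skeleton (sha16 `4ebf5683127b`),
# WALL `stub_scalarLiouville`: generalized Beltrami modulo a constant drift ON ONE OPEN SET at accumulating times ⇒ irrotational

Support file (seat leafhand-ns-unthreadeddoor-2 g4, cell decomp-ns), `--supports stmt-NavierStokesRegularity-1222 --as helper`; theorems only.

Local form of `ModConst.curl_eq_zero_of_lamb_curlFree_modConst_frequently` (p822418): it suffices that at each of the accumulating times the Lamb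
vector in SOME constant frame is curl-free on SOME non-empty open set (frame and set depending on the time) — in the analytic frame of the class
(`CellFlux.unthreadedAnalyticOrIrrotational`) the slice `x ↦ curl ((v(t) − b) × curl v(t))(x)` is real-analytic on the connected `ℝ³`, so it vanishes
identically as soon as it vanishes on an open set (identity theorem), and the global closer applies.

* ★★ `curl_eq_zero_of_lamb_curlFree_modConst_on_open_frequently`, `constant_of_lamb_curlFree_modConst_on_open_frequently`.

HONEST LABEL: a corollary (identity theorem in space + p822418); the generic core of the wall (= (ML-a)) is OPEN; nothing here proves
`stub_scalarLiouville`, `PoloidalLiouville` (1222), or bears on Navier–Stokes regularity; no summit statement is proved.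
[folklore] [cite: KochNadirashviliSereginSverak2009, Thm 5.2 (arXiv:0709.3599 pp. 9–10)]
-/

noncomputable section

-- the summit and its single sub-problem share the name (CONVENTIONS §1)
set_option linter.dupNamespace false

open scoped Topology InnerProductSpace RealInnerProductSpace
open Filter Set Function MeasureTheory
open Literature.Analysis Literature.Analysis.FluidPDE

namespace Summit.NavierStokesRegularity.NavierStokesRegularity.Theorems.PoloidalLiouville.Antidynamo

open Summit.NavierStokesRegularity.NavierStokesRegularity.Theorems.PoloidalLiouville
  (toroidalPotential exists_norm_curl_le constantOfIrrotational)
open Summit.NavierStokesRegularity.NavierStokesRegularity.Theorems.PoloidalLiouville.NetFlux (E3)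

namespace ModConst

/-- **The Lamb-curl slice `x ↦ curl ((V(t) − b) × curl V(t))(x)` is real-analytic on `ℝ³`** in a jointly analytic frame. [folklore] -/
theorem analyticOnNhd_curl_lamb_space {V : ℝ → E3 → E3} (b : E3)
    (hV : AnalyticOnNhd ℝ (uncurry V) (Iio (0 : ℝ) ×ˢ (univ : Set E3))) {t : ℝ} (ht : t < 0) :
    AnalyticOnNhd ℝ (fun x => curl (fun y => cross (V t y - b) (curl (V t) y)) x) univ := by
  have hL := CellFlux.analyticOnNhd_curl_uncurry (V := fun t y => cross (V t y - b) (curl (V t) y))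
    (OneInstant.analyticOnNhd_lamb_uncurry b hV)
  intro x _
  exact (hL (t, x) ⟨ht, mem_univ _⟩).comp₂ analyticAt_const analyticAt_id

/-- ★★ **GENERALIZED BELTRAMI MODULO A CONSTANT DRIFT ON AN OPEN SET, AT ACCUMULATING TIMES ⇒ IRROTATIONAL.**  Let `v` be a bounded ancient mild solution
(`ν = 1`, duality class) with measurable slices, jointly smooth on `(−∞,0) × ℝ³`, whose vorticity is tangent to the spheres about `x₀`.  If at a set of
times accumulating at some `t₀ < 0` there are a constant `b` and a non-empty open set `U` (both depending on the time) with
`curl ((v(t) − b) × curl v(t)) = 0` on `U`, then `curl v ≡ 0` on `(−∞,0) × ℝ³`.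
[cite: KochNadirashviliSereginSverak2009, Thm 5.2 (arXiv:0709.3599 pp. 9–10)] -/
theorem curl_eq_zero_of_lamb_curlFree_modConst_on_open_frequently
    (v : ℝ → EuclideanSpace ℝ (Fin 3) → EuclideanSpace ℝ (Fin 3)) (x₀ : EuclideanSpace ℝ (Fin 3))
    (hB : Literature.Analysis.FluidPDE.IsBoundedAncientMildSolution 1 v)
    (hm : ∀ t < 0, AEStronglyMeasurable (v t) volume)
    (hsm : ContDiffOn ℝ (⊤ : ℕ∞) (Function.uncurry v) (Set.Iio 0 ×ˢ Set.univ))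
    (hun : ∀ t < 0, ∀ x, ⟪x - x₀, curl (v t) x⟫ = 0)
    (hfr : ∃ t₀ < 0, ∃ᶠ t in 𝓝[≠] t₀, ∃ b : EuclideanSpace ℝ (Fin 3), ∃ U : Set (EuclideanSpace ℝ (Fin 3)),
      IsOpen U ∧ U.Nonempty ∧ ∀ x ∈ U, curl (fun y => cross (v t y - b) (curl (v t) y)) x = 0) :
    ∀ t < 0, ∀ x, curl (v t) x = 0 := by
  obtain ⟨t₀, ht₀, hfr⟩ := hfr
  obtain ⟨K, hK⟩ := exists_norm_curl_le hB hsm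
  obtain ⟨T, -, -, hlink⟩ := toroidalPotential v x₀ K hsm hK hun
  rcases CellFlux.unthreadedAnalyticOrIrrotational v x₀ T hB hm hsm hlink with hA | hZ
  swap
  · exact hZ
  have hneg0 : ∀ᶠ t in 𝓝 t₀, t < 0 := Iio_mem_nhds ht₀
  have hneg : ∀ᶠ t in 𝓝[≠] t₀, t < 0 := hneg0.filter_mono nhdsWithin_le_nhds
  refine curl_eq_zero_of_lamb_curlFree_modConst_frequently v x₀ hB hm hsm hun ⟨t₀, ht₀, ?_⟩
  refine (hfr.and_eventually hneg).mono fun t ⟨⟨b, U, hU, ⟨x₁, hx₁⟩, hzero⟩, ht⟩ => ⟨b, fun x => ?_⟩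
  have hev : (fun x => curl (fun y => cross (v t y - b) (curl (v t) y)) x) =ᶠ[𝓝 x₁] 0 :=
    Filter.eventuallyEq_iff_exists_mem.2 ⟨U, hU.mem_nhds hx₁, fun x hx => hzero x hx⟩
  have h0 := (analyticOnNhd_curl_lamb_space b hA ht).eqOn_zero_of_preconnected_of_eventuallyEq_zero isPreconnected_univ
    (mem_univ x₁) hev (mem_univ x)
  simpa only [Pi.zero_apply] using h0

/-- ★★ **… HENCE SLICE-WISE CONSTANT.** [cite: KochNadirashviliSereginSverak2009, Thm 5.2 (arXiv:0709.3599 pp. 9–10)] -/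
theorem constant_of_lamb_curlFree_modConst_on_open_frequently
    (v : ℝ → EuclideanSpace ℝ (Fin 3) → EuclideanSpace ℝ (Fin 3)) (x₀ : EuclideanSpace ℝ (Fin 3))
    (hB : Literature.Analysis.FluidPDE.IsBoundedAncientMildSolution 1 v)
    (hm : ∀ t < 0, AEStronglyMeasurable (v t) volume)
    (hsm : ContDiffOn ℝ (⊤ : ℕ∞) (Function.uncurry v) (Set.Iio 0 ×ˢ Set.univ))
    (hun : ∀ t < 0, ∀ x, ⟪x - x₀, curl (v t) x⟫ = 0)
    (hfr : ∃ t₀ < 0, ∃ᶠ t in 𝓝[≠] t₀, ∃ b : EuclideanSpace ℝ (Fin 3), ∃ U : Set (EuclideanSpace ℝ (Fin 3)),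
      IsOpen U ∧ U.Nonempty ∧ ∀ x ∈ U, curl (fun y => cross (v t y - b) (curl (v t) y)) x = 0) :
    ∀ t < 0, ∃ c : EuclideanSpace ℝ (Fin 3), ∀ x, v t x = c :=
  constantOfIrrotational v hB hsm (curl_eq_zero_of_lamb_curlFree_modConst_on_open_frequently v x₀ hB hm hsm hun hfr)

end ModConst

end Summit.NavierStokesRegularity.NavierStokesRegularity.Theorems.PoloidalLiouville.Antidynamo

end
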